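import Summits.Parity.GeneralizedHardyLittlewood.Theorems.PrimeLevelFamEdgeMomentsBeyondDiagonalDiagDecorMomentCoord
import Summits.Parity.GeneralizedHardyLittlewood.Theorems.PrimeLevelFamEdgeMomentsBeyondDiagonalDiagDecorOneSidedCrudeFamily
import Summits.Parity.GeneralizedHardyLittlewood.Theorems.PrimeLevelFamEdgeMomentsBeyondDiagonalDiagDecorTwoSidedCrudeFamily
import HarnessLib

/-!
# Route `PrimeLevelFamEdge`, crux K_A `MomentsBeyondDiagonal` (stmt-Parity-20007), line «petersson_layers» v4, stub `stub_diag`: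
# **THE `m_r`-DECORATED SELBERG-FORM FAMILY BOUNDS FOR EVERY MOMENT ORDER — one-sided `|Sel(τm_r(k₁)·τ(k₂)·L^m)| ≤ C·log^m M`,
# two-sided `|Sel(τm_r(k₁)·τm_s(k₂)·L^m)| ≤ C·log^{m+1}M` (all `r, s`, all `m`)**

Second brick of the generic order `(i,j)` of `stub_diag` (census `Lines/petersson_layers_stub_diag_g18_rung4.md`, item (G2)): the generic
crude families of lineage famedge-2 (`…DiagDecorOneSidedCrudeFamily.abs_selbergOneSidedCrudeLpow_le`, `…TwoSidedCrudeFamily.abs_selbergDecorTwoCrudeLpow_le`)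
fed with the every-order coordinate bounds of `…DiagDecorMomentCoord` («DRTAIL»_r + Abel). The sharp coordinate size is `K·D(n)·log^ρM`
(exponent `e = 0` in BOTH the `(1+κ)`-weighted and the plain hypothesis shapes of the two-sided family), recorded here as well:

* `abs_shiftedCoord_logDiff_crude_le` / `abs_shiftedCoord_logDiff_kappa_le` — `|T_{m_r}^{[ρ]}(M;n)| ≤ K·D(n)·log^ρM`, resp. `≤ K·D(n)(1+κ(n))·log^ρM`;
* `abs_selbergMomentTau_Lpow_le`, `abs_selbergTauMoment_Lpow_le` — **one-sided, every `r`, every `m`: `≤ C·log^m M`** (`P₀ = P₁ = 0`,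
  `0 ≤ λ ≤ 1`, `M ≥ 3`; decoration `τ(k)·m_r(k) = Σ_{de=k}(log d − log e)^r` written as `τ(k)·(S_r(k)/τ(k))`);
* `abs_selbergMomentMoment_Lpow_le`, `abs_selbergMomentMoment_Lpow_le'` — **two-sided, every `r, s`, every `m`: `≤ C·log^{m+1}M`** (any `P`).

These replace, for all decorations of total degree `≥ 4` at once, the per-decoration engines `…DiagDecorM4/M6/M8Family`, `…M4P2/M6P2/M4M4Family`
of rungs 2–4 (which they also re-prove with equal or smaller exponents: `m` vs `m, m+2, m+4`; `m+1` vs `m+2, m+4, m+4`). What the generic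
order still needs on the polynomial side is only the undecorated / `P₂` / `P₂⊗P₂` main-term engines (in the tree for every `m`) and the
bookkeeping of `…DiagDecorOrderHecke.heckeSum_order_eq i j`. Def-free; theorems only. Helper `--supports stmt-Parity-20007`; closes nothing;
K_A, K_B and the Parity summit are NOT proved; nothing about Landau–Siegel zeros.

## References
* E. Kowalski, P. Michel, J. VanderKam, J. reine angew. Math. 526 (2000), (23)–(28) pp. 13–15 and Prop. 5.1 p. 18.
  [cite: KowalskiMichelVanderKam2000, (23)–(28) and Prop. 5.1 — derivation (divisor-log moments of the Selberg coordinates, every order)]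
-/

noncomputable section

open scoped Real ArithmeticFunction.Moebius
open Finset ArithmeticFunction Polynomial

namespace Summit.Parity.GeneralizedHardyLittlewood.Theorems.MomentsBeyondDiagonal.DiagKernel

open Literature.NumberTheory.LFunctions Literature.NumberTheory.LFunctions.KMV2000
open MollifierMainTerm (W)
open SelbergCoord (kappa)
open Literature.NumberTheory.Sieve (one_le_log_of_three_le)
open Summit.Parity.GeneralizedHardyLittlewood.Theorems.BeyondDiagonalBeatsQuarter.KernelFormXSq (divWeight divWeight_nonneg)

/-! ### The sharp coordinate sizes (`e = 0` in both hypothesis shapes) -/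

/-- **`|T_{m_r}^{[ρ]}(M;n)| ≤ K·D(n)·log^ρ M`** (`M ≥ 3`, `1 ≤ n ≤ M`, any profile `P`, every `r`, `ρ`).
[cite: KowalskiMichelVanderKam2000, (23)–(28) — derivation (divisor-log moments of the Selberg coordinates)] -/
theorem abs_shiftedCoord_logDiff_crude_le (r : ℕ) (P : ℝ[X]) (ρ : ℕ) :
    ∃ K : ℝ, 0 ≤ K ∧ ∀ M : ℝ, 3 ≤ M → ∀ n : ℕ, n ≠ 0 → (n : ℝ) ≤ M →
      |∑ c ∈ Finset.range (P.natDegree + 1), P.coeff c *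
          ((∑ k ∈ Icc 1 ⌊M / n⌋₊, (if k.Coprime n then W k else 0) *
              ((k.divisors.card : ℝ) *
                ((∑ z ∈ k.divisorsAntidiagonal, (Real.log z.1 - Real.log z.2) ^ r) / (k.divisors.card : ℝ))) *
            Real.log (M / n / k) ^ (c + ρ)) / Real.log M ^ c)| ≤
        K * divWeight n * Real.log M ^ ρ := by
  classical
  obtain ⟨C, hC0, hC⟩ := abs_sum_Wn_logDiff_pow_mul_log_pow_le r
  set K : ℝ := ∑ c ∈ Finset.range (P.natDegree + 1), |P.coeff c| * C with hK
  have hK0 : 0 ≤ K := Finset.sum_nonneg fun c _ ↦ by positivity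
  refine ⟨K, hK0, fun M hM n hn hnM ↦ ?_⟩
  set ℓ := Real.log M with hℓ
  have hℓ1 : 1 ≤ ℓ := one_le_log_of_three_le hM
  have hℓ0 : 0 < ℓ := by linarith
  have hD := divWeight_nonneg n
  obtain ⟨hY0, hYℓ⟩ := log_div_nonneg_and_le hM hn hnM
  have hn0 : (0 : ℝ) < n := by exact_mod_cast Nat.pos_of_ne_zero hn
  have hy1 : 1 ≤ M / n := (one_le_div hn0).2 hnM
  have hre : ∀ c : ℕ, ∑ k ∈ Icc 1 ⌊M / n⌋₊, (if k.Coprime n then W k else 0) *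
        ((k.divisors.card : ℝ) *
          ((∑ z ∈ k.divisorsAntidiagonal, (Real.log z.1 - Real.log z.2) ^ r) / (k.divisors.card : ℝ))) *
        Real.log (M / n / k) ^ (c + ρ) =
      ∑ k ∈ Icc 1 ⌊M / n⌋₊, (if k.Coprime n then W k else 0) *
        (∑ z ∈ k.divisorsAntidiagonal, (Real.log z.1 - Real.log z.2) ^ r) * Real.log (M / n / k) ^ (c + ρ) := by
    intro c
    refine Finset.sum_congr rfl fun k hk ↦ ?_
    have hk0 : k ≠ 0 := by have := (Finset.mem_Icc.1 hk).1; omega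
    have hτ : (k.divisors.card : ℝ) ≠ 0 := by
      have : 0 < k.divisors.card := Finset.card_pos.2 ⟨k, Nat.mem_divisors_self k hk0⟩
      exact_mod_cast this.ne'
    rw [mul_div_cancel₀ _ hτ]
  have hterm : ∀ c ∈ Finset.range (P.natDegree + 1),
      |P.coeff c * ((∑ k ∈ Icc 1 ⌊M / n⌋₊, (if k.Coprime n then W k else 0) *
          ((k.divisors.card : ℝ) *
            ((∑ z ∈ k.divisorsAntidiagonal, (Real.log z.1 - Real.log z.2) ^ r) / (k.divisors.card : ℝ))) *
          Real.log (M / n / k) ^ (c + ρ)) / ℓ ^ c)| ≤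
        |P.coeff c| * C * (divWeight n * ℓ ^ ρ) := by
    intro c _
    rw [hre c, abs_mul, abs_div, abs_of_pos (pow_pos hℓ0 c)]
    have hS := hC n hn (c + ρ) (M / n) hy1
    have hB : C * divWeight n * Real.log (M / n) ^ (c + ρ) ≤ (C * (divWeight n * ℓ ^ ρ)) * ℓ ^ c := by
      have h1 : Real.log (M / n) ^ (c + ρ) ≤ ℓ ^ (c + ρ) := pow_le_pow_left₀ hY0 hYℓ _
      calc C * divWeight n * Real.log (M / n) ^ (c + ρ) ≤ C * divWeight n * ℓ ^ (c + ρ) := by gcongr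
        _ = (C * (divWeight n * ℓ ^ ρ)) * ℓ ^ c := by ring
    have hB' := (div_le_iff₀ (pow_pos hℓ0 c)).2 (hS.trans hB)
    calc _ ≤ |P.coeff c| * (C * (divWeight n * ℓ ^ ρ)) := mul_le_mul_of_nonneg_left hB' (abs_nonneg _)
      _ = _ := by ring
  calc _ ≤ ∑ c ∈ Finset.range (P.natDegree + 1), |P.coeff c * ((∑ k ∈ Icc 1 ⌊M / n⌋₊, (if k.Coprime n then W k else 0) *
          ((k.divisors.card : ℝ) *
            ((∑ z ∈ k.divisorsAntidiagonal, (Real.log z.1 - Real.log z.2) ^ r) / (k.divisors.card : ℝ))) *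
          Real.log (M / n / k) ^ (c + ρ)) / ℓ ^ c)| := Finset.abs_sum_le_sum_abs _ _
    _ ≤ ∑ c ∈ Finset.range (P.natDegree + 1), |P.coeff c| * C * (divWeight n * ℓ ^ ρ) := Finset.sum_le_sum hterm
    _ = K * divWeight n * ℓ ^ ρ := by
        rw [hK, Finset.sum_mul, Finset.sum_mul]
        exact Finset.sum_congr rfl fun c _ ↦ by ring

/-- **`|T_{m_r}^{[ρ]}(M;n)| ≤ K·D(n)(1+κ(n))·log^ρ M`** — the `(1+κ)`-weighted hypothesis shape with `e = 0`.
[cite: KowalskiMichelVanderKam2000, (23)–(28) — derivation (divisor-log moments of the Selberg coordinates)] -/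
theorem abs_shiftedCoord_logDiff_kappa_le (r : ℕ) (P : ℝ[X]) (ρ : ℕ) :
    ∃ K : ℝ, 0 ≤ K ∧ ∀ M : ℝ, 3 ≤ M → ∀ n : ℕ, n ≠ 0 → (n : ℝ) ≤ M →
      |∑ c ∈ Finset.range (P.natDegree + 1), P.coeff c *
          ((∑ k ∈ Icc 1 ⌊M / n⌋₊, (if k.Coprime n then W k else 0) *
              ((k.divisors.card : ℝ) *
                ((∑ z ∈ k.divisorsAntidiagonal, (Real.log z.1 - Real.log z.2) ^ r) / (k.divisors.card : ℝ))) *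
            Real.log (M / n / k) ^ (c + ρ)) / Real.log M ^ c)| ≤
        K * divWeight n * (1 + kappa n) * Real.log M ^ ρ := by
  obtain ⟨K, hK0, h⟩ := abs_shiftedCoord_logDiff_crude_le r P ρ
  refine ⟨K, hK0, fun M hM n hn hnM ↦ (h M hM n hn hnM).trans ?_⟩
  have hκ : 0 ≤ kappa n := by
    unfold kappa
    exact Finset.sum_nonneg fun p hp ↦ by
      have hp2 : (2 : ℝ) ≤ p := by exact_mod_cast (Nat.prime_of_mem_primeFactors hp).two_le
      exact div_nonneg (Real.log_nonneg (by linarith)) (by linarith)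
  have hℓ : 0 ≤ Real.log M ^ ρ := pow_nonneg (by linarith [one_le_log_of_three_le hM]) ρ
  have hD := divWeight_nonneg n
  have : K * divWeight n * Real.log M ^ ρ * 1 ≤ K * divWeight n * Real.log M ^ ρ * (1 + kappa n) :=
    mul_le_mul_of_nonneg_left (by linarith) (by positivity)
  linarith

/-! ### One-sided families, every moment order -/

/-- **One-sided family, decoration on `k₁`, every `r`, every `m`: `|Sel(τm_r(k₁)·τ(k₂)·L^m)| ≤ C·log^m M`** (`P₀ = P₁ = 0`,
`0 ≤ λ ≤ 1`, `M ≥ 3`). [cite: KowalskiMichelVanderKam2000, (23)–(28) — derivation (diagonal main term in real Selberg coordinates)] -/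
theorem abs_selbergMomentTau_Lpow_le (r : ℕ) (P : ℝ[X]) (hP0 : P.coeff 0 = 0) (hP1 : P.coeff 1 = 0) (m : ℕ)
    {lam : ℝ} (hlam0 : 0 ≤ lam) (hlam1 : lam ≤ 1) :
    ∃ C : ℝ, 0 < C ∧ ∀ M : ℝ, 3 ≤ M →
      |∑ c ∈ Icc 1 ⌊M⌋₊, ∑ g ∈ Icc 1 (⌊M⌋₊ / c), (μ g : ℝ) * c *
          ∑ k₁ ∈ Icc 1 (⌊M⌋₊ / (c * g)), ∑ k₂ ∈ Icc 1 (⌊M⌋₊ / (c * g)),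
            ((μ (c * g * k₁) : ℝ) * ((psi (c * g * k₁))⁻¹ *
                P.eval (Real.log (M / ((c * g * k₁ : ℕ) : ℝ)) / Real.log M))) / ((c * g * k₁ : ℕ) : ℝ) *
              (((μ (c * g * k₂) : ℝ) * ((psi (c * g * k₂))⁻¹ *
                P.eval (Real.log (M / ((c * g * k₂ : ℕ) : ℝ)) / Real.log M))) / ((c * g * k₂ : ℕ) : ℝ)) *
              ((k₁.divisors.card : ℝ) * ((∑ z ∈ k₁.divisorsAntidiagonal, (Real.log z.1 - Real.log z.2) ^ r) / (k₁.divisors.card : ℝ)) *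
                (k₂.divisors.card : ℝ) * (2 * (lam * Real.log M) - 2 * Real.log g - Real.log k₁ - Real.log k₂) ^ m)| ≤
        C * Real.log M ^ m :=
  abs_selbergOneSidedCrudeLpow_le
    (fun k ↦ (∑ z ∈ k.divisorsAntidiagonal, (Real.log z.1 - Real.log z.2) ^ r) / (k.divisors.card : ℝ)) 0 P hP0 hP1
    (fun ρ ↦ abs_shiftedCoord_logDiff_le r P ρ) m hlam0 hlam1

/-- **One-sided family, decoration on `k₂`** (mirror of `abs_selbergMomentTau_Lpow_le`).
[cite: KowalskiMichelVanderKam2000, (23)–(28) — derivation (diagonal main term in real Selberg coordinates)] -/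
theorem abs_selbergTauMoment_Lpow_le (r : ℕ) (P : ℝ[X]) (hP0 : P.coeff 0 = 0) (hP1 : P.coeff 1 = 0) (m : ℕ)
    {lam : ℝ} (hlam0 : 0 ≤ lam) (hlam1 : lam ≤ 1) :
    ∃ C : ℝ, 0 < C ∧ ∀ M : ℝ, 3 ≤ M →
      |∑ c ∈ Icc 1 ⌊M⌋₊, ∑ g ∈ Icc 1 (⌊M⌋₊ / c), (μ g : ℝ) * c *
          ∑ k₁ ∈ Icc 1 (⌊M⌋₊ / (c * g)), ∑ k₂ ∈ Icc 1 (⌊M⌋₊ / (c * g)),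
            ((μ (c * g * k₁) : ℝ) * ((psi (c * g * k₁))⁻¹ *
                P.eval (Real.log (M / ((c * g * k₁ : ℕ) : ℝ)) / Real.log M))) / ((c * g * k₁ : ℕ) : ℝ) *
              (((μ (c * g * k₂) : ℝ) * ((psi (c * g * k₂))⁻¹ *
                P.eval (Real.log (M / ((c * g * k₂ : ℕ) : ℝ)) / Real.log M))) / ((c * g * k₂ : ℕ) : ℝ)) *
              ((k₁.divisors.card : ℝ) * ((k₂.divisors.card : ℝ) *
                ((∑ z ∈ k₂.divisorsAntidiagonal, (Real.log z.1 - Real.log z.2) ^ r) / (k₂.divisors.card : ℝ))) *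
                (2 * (lam * Real.log M) - 2 * Real.log g - Real.log k₁ - Real.log k₂) ^ m)| ≤
        C * Real.log M ^ m :=
  abs_selbergOneSidedCrudeLpow_le'
    (fun k ↦ (∑ z ∈ k.divisorsAntidiagonal, (Real.log z.1 - Real.log z.2) ^ r) / (k.divisors.card : ℝ)) 0 P hP0 hP1
    (fun ρ ↦ abs_shiftedCoord_logDiff_le r P ρ) m hlam0 hlam1

/-! ### Two-sided families, every pair of moment orders -/

/-- **Two-sided family, every `r, s`, every `m`: `|Sel(τm_r(k₁)·τm_s(k₂)·L^m)| ≤ C·log^{m+1}M`** (any `P`, `0 ≤ λ ≤ 1`, `M ≥ 3`).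
[cite: KowalskiMichelVanderKam2000, (23)–(28) — derivation (diagonal main term in real Selberg coordinates)] -/
theorem abs_selbergMomentMoment_Lpow_le (r s : ℕ) (P : ℝ[X]) (m : ℕ) {lam : ℝ} (hlam0 : 0 ≤ lam) (hlam1 : lam ≤ 1) :
    ∃ C : ℝ, 0 < C ∧ ∀ M : ℝ, 3 ≤ M →
      |∑ c ∈ Icc 1 ⌊M⌋₊, ∑ g ∈ Icc 1 (⌊M⌋₊ / c), (μ g : ℝ) * c *
          ∑ k₁ ∈ Icc 1 (⌊M⌋₊ / (c * g)), ∑ k₂ ∈ Icc 1 (⌊M⌋₊ / (c * g)),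
            ((μ (c * g * k₁) : ℝ) * ((psi (c * g * k₁))⁻¹ *
                P.eval (Real.log (M / ((c * g * k₁ : ℕ) : ℝ)) / Real.log M))) / ((c * g * k₁ : ℕ) : ℝ) *
              (((μ (c * g * k₂) : ℝ) * ((psi (c * g * k₂))⁻¹ *
                P.eval (Real.log (M / ((c * g * k₂ : ℕ) : ℝ)) / Real.log M))) / ((c * g * k₂ : ℕ) : ℝ)) *
              ((k₁.divisors.card : ℝ) * ((∑ z ∈ k₁.divisorsAntidiagonal, (Real.log z.1 - Real.log z.2) ^ r) / (k₁.divisors.card : ℝ)) * ((k₂.divisors.card : ℝ) * ((∑ z ∈ k₂.divisorsAntidiagonal, (Real.log z.1 - Real.log z.2) ^ s) / (k₂.divisors.card : ℝ))) *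
                (2 * (lam * Real.log M) - 2 * Real.log g - Real.log k₁ - Real.log k₂) ^ m)| ≤
        C * Real.log M ^ (m + 1) :=
  abs_selbergDecorTwoCrudeLpow_le
    (fun k ↦ (∑ z ∈ k.divisorsAntidiagonal, (Real.log z.1 - Real.log z.2) ^ r) / (k.divisors.card : ℝ))
    (fun k ↦ (∑ z ∈ k.divisorsAntidiagonal, (Real.log z.1 - Real.log z.2) ^ s) / (k.divisors.card : ℝ)) 0 0 P
    (fun ρ ↦ abs_shiftedCoord_logDiff_kappa_le r P ρ) (fun ρ ↦ abs_shiftedCoord_logDiff_crude_le s P ρ) m hlam0 hlam1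

/-- **Two-sided family, mirror** (`m_r` on `k₂`, `m_s` on `k₁`).
[cite: KowalskiMichelVanderKam2000, (23)–(28) — derivation (diagonal main term in real Selberg coordinates)] -/
theorem abs_selbergMomentMoment_Lpow_le' (r s : ℕ) (P : ℝ[X]) (m : ℕ) {lam : ℝ} (hlam0 : 0 ≤ lam) (hlam1 : lam ≤ 1) :
    ∃ C : ℝ, 0 < C ∧ ∀ M : ℝ, 3 ≤ M →
      |∑ c ∈ Icc 1 ⌊M⌋₊, ∑ g ∈ Icc 1 (⌊M⌋₊ / c), (μ g : ℝ) * c *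
          ∑ k₁ ∈ Icc 1 (⌊M⌋₊ / (c * g)), ∑ k₂ ∈ Icc 1 (⌊M⌋₊ / (c * g)),
            ((μ (c * g * k₁) : ℝ) * ((psi (c * g * k₁))⁻¹ *
                P.eval (Real.log (M / ((c * g * k₁ : ℕ) : ℝ)) / Real.log M))) / ((c * g * k₁ : ℕ) : ℝ) *
              (((μ (c * g * k₂) : ℝ) * ((psi (c * g * k₂))⁻¹ *
                P.eval (Real.log (M / ((c * g * k₂ : ℕ) : ℝ)) / Real.log M))) / ((c * g * k₂ : ℕ) : ℝ)) *
              ((k₁.divisors.card : ℝ) * ((∑ z ∈ k₁.divisorsAntidiagonal, (Real.log z.1 - Real.log z.2) ^ s) / (k₁.divisors.card : ℝ)) * ((k₂.divisors.card : ℝ) * ((∑ z ∈ k₂.divisorsAntidiagonal, (Real.log z.1 - Real.log z.2) ^ r) / (k₂.divisors.card : ℝ))) *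
                (2 * (lam * Real.log M) - 2 * Real.log g - Real.log k₁ - Real.log k₂) ^ m)| ≤
        C * Real.log M ^ (m + 1) :=
  abs_selbergDecorTwoCrudeLpow_le'
    (fun k ↦ (∑ z ∈ k.divisorsAntidiagonal, (Real.log z.1 - Real.log z.2) ^ r) / (k.divisors.card : ℝ))
    (fun k ↦ (∑ z ∈ k.divisorsAntidiagonal, (Real.log z.1 - Real.log z.2) ^ s) / (k.divisors.card : ℝ)) 0 0 P
    (fun ρ ↦ abs_shiftedCoord_logDiff_kappa_le r P ρ) (fun ρ ↦ abs_shiftedCoord_logDiff_crude_le s P ρ) m hlam0 hlam1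

end Summit.Parity.GeneralizedHardyLittlewood.Theorems.MomentsBeyondDiagonal.DiagKernel

end
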